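import Summits.Ventures.CertifiedArithmetic.LowPrec.GemmThetaE2M1Fp16Check01
import Summits.Ventures.CertifiedArithmetic.LowPrec.GemmThetaE2M1Fp16Check02
import Summits.Ventures.CertifiedArithmetic.LowPrec.GemmThetaE2M1Fp16Check03
import Summits.Ventures.CertifiedArithmetic.LowPrec.GemmThetaE2M1Fp16Check04
import Summits.Ventures.CertifiedArithmetic.LowPrec.GemmThetaE2M1Fp16Check05
import Summits.Ventures.CertifiedArithmetic.LowPrec.GemmThetaE2M1Fp16Check06
import Summits.Ventures.CertifiedArithmetic.LowPrec.GemmThetaE2M1Fp16Check07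
import Summits.Ventures.CertifiedArithmetic.LowPrec.GemmThetaE2M1Fp16Check08
import Summits.Ventures.CertifiedArithmetic.LowPrec.GemmThetaE2M1Fp16Check09
import Summits.Ventures.CertifiedArithmetic.LowPrec.GemmThetaE2M1

/-!
# The θ-certificate of E2M1²→binary16 assembled: `thetaCert_E2M1_Binary16`

HONEST FRAMING (venture CertifiedArithmetic / cell `pub-lowprec`, seat gemm, gen 10): certified error
envelopes and provably optimal rounding/accumulation schemes for low-precision formats under stated
cost models; every table by two implementations; no hardware or vendor claims.

Paper `gemm.tex` §Regimes, Prop. "the terminal constant bounds the defect for every n" (i), instance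
E2M1·E2M1 products (FP4, [RouhaniEtAl2023MX]) accumulated sequentially in IEEE `binary16` under
round-to-nearest-even — the cell's model `seqSum Format.Binary16`, whose rounding `roundNE` saturates
at `±65504` (IEEE arithmetic on every input none of whose partial sums reaches `65520`).  The
kernel-checked Boolean certificate of `GemmThetaE2M1Fp16Defs.lean` / `GemmThetaE2M1Fp16Check01…09.lean`
(2 · 9216 states × 37 letters = 681,984 edges, closed-form potential `Φ`, constants `θ = 833/4`,
`ρ = 7/2`, `β_pair = 23/2`, `κ = 4/833`) is turned into a `ThetaCertificate`
(`thetaCert_E2M1_Binary16`) for the letter predicate `· ∈ piE2M1` (`piE2M1 = lamQ / 4`,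
`GemmTieChains.lean` / `GemmThetaE2M1.lean`) through the total bridge `flStep_binary16`
(`GemmBinary16Step.lean`, no size side condition), so that the generic soundness theorem
`ThetaCertificate.defect_bound` gives `1666/(8n + 20825) ≤ 1 - (ŝ - Σ x)/Σ|x|` for every input —
`GemmThetaE2M1Fp16Bound.lean` states it for E2M1 data and sandwiches `W(n)` with the tie-chain lower
bound `TieChain.fp16_5649_ratio` of `GemmTerminalBinary16.lean`.  This is the last row of the
paper's Θ-instance table without a kernel-checked lower side of `1 - W(n)`, and the first with a
`binary16` accumulator.
-/

namespace Literature.ComputerArithmetic.FloatingPoint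

namespace MiniFloat

open Finset ThetaE2M1Fp16

namespace ThetaE2M1Fp16

open ThetaE2M1 (lamQ exists_of_mem_piE2M1)

/-! ### The dictionary on the quarter grid -/

/-- `fl_binary16(V/4 + Q/4) = rneB16 2 (V + Q)/4` (the total bridge at `g = 2`). [cell; GemmBinary16Step] -/
theorem flStep_h (V Q : ℤ) :
    flStep Format.Binary16 ((V : ℚ) / 4) ((Q : ℚ) / 4) = (rneB16 2 (V + Q) : ℚ) / 4 := by
  have h := flStep_binary16 (g := 2) (by norm_num) V Q
  simp only [show ((2 : ℚ) ^ 2) = 4 by norm_num] at h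
  exact h

/-- The gain of a `binary16` step on the quarter grid. [cell] -/
theorem gainOf_h (V Q : ℤ) :
    gainOf Format.Binary16 ((V : ℚ) / 4) ((Q : ℚ) / 4) = ((rneB16 2 (V + Q) - V - Q : ℤ) : ℚ) / 4 := by
  have h := gainOf_binary16 (g := 2) (by norm_num) V Q
  simp only [show ((2 : ℚ) ^ 2) = 4 by norm_num] at h
  exact h

/-- The deficit of a `binary16` step on the quarter grid. [cell] -/
theorem deficitOf_h (V Q : ℤ) :
    deficitOf Format.Binary16 ((V : ℚ) / 4) ((Q : ℚ) / 4)
      = (((Q.natAbs : ℤ) - (rneB16 2 (V + Q) - V - Q) : ℤ) : ℚ) / 4 := by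
  have h := deficitOf_binary16 (g := 2) (by norm_num) V Q
  simp only [show ((2 : ℚ) ^ 2) = 4 by norm_num] at h
  exact h

/-- THE POTENTIAL as a function on `ℚ`: `Φ(v) = psiZ(4v)/4`. [cell, gemm.tex §Regimes] -/
def psiH (v : ℚ) : ℚ := (psiZ ⌊v * 4⌋ : ℚ) / 4

/-- `Φ(V/4) = psiZ V / 4` for the `binary16` row. [cell] -/
theorem psiH_quarter (V : ℤ) : psiH ((V : ℚ) / 4) = (psiZ V : ℚ) / 4 := by
  unfold psiH; rw [div_mul_cancel₀ (V : ℚ) (by norm_num : (4 : ℚ) ≠ 0), Int.floor_intCast]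

/-- THE STATE SET: `± valG i / 4`, `i < 9216` — every `binary16` value on the quarter grid.
[cell, gemm.tex §Regimes] -/
def SH (v : ℚ) : Prop := ∃ σ : Bool, ∃ i : ℕ, i < 9216 ∧ v = (sval σ i : ℚ) / 4

/-- A magnitude recognised by the closure check is a state. [cell] -/
theorem SH_of_idx {W : ℤ} (h1 : idxG W.natAbs < 9216) (h2 : valG (idxG W.natAbs) = W.natAbs) :
    SH ((W : ℚ) / 4) := by
  refine ⟨decide (W < 0), idxG W.natAbs, h1, ?_⟩
  have : sval (decide (W < 0)) (idxG W.natAbs) = W := by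
    unfold sval; rw [h2]
    by_cases hW : W < 0
    · simp only [hW, decide_true, if_true]; omega
    · simp only [hW, decide_false, Bool.false_eq_true, if_false]; omega
  rw [this]

/-! ### From the chunked Boolean theorems to one statement per edge -/

/-- THE WHOLE TABLE: every edge of the graph passes `edgeOK` (the 9 kernel-checked parts
concatenated). [cell certificate, kernel-checked in Check01…09] -/
theorem all_ok : rowsOK 0 9216 = true :=
  rowsOK_append 0 1024 8192 part_01 <|
  rowsOK_append 1024 1024 7168 part_02 <|
  rowsOK_append 2048 1024 6144 part_03 <|
  rowsOK_append 3072 1024 5120 part_04 <|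
  rowsOK_append 4096 1024 4096 part_05 <|
  rowsOK_append 5120 1024 3072 part_06 <|
  rowsOK_append 6144 1024 2048 part_07 <|
  rowsOK_append 7168 1024 1024 part_08 <|
  part_09

/-- Every edge of the `binary16` graph passes `edgeOK`. [cell certificate, kernel-checked] -/
theorem edge_ok (σ : Bool) {i : ℕ} (hi : i < 9216) {Q : ℤ} (hQ : Q ∈ lamQ) :
    edgeOK σ i Q = true := by
  have h := all_ok
  unfold rowsOK at h
  have h1 := List.all_eq_true.mp h i (List.mem_range'_1.mpr ⟨Nat.zero_le _, by omega⟩)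
  have h2 := List.all_eq_true.mp h1 Q hQ
  rw [Bool.and_eq_true] at h2
  cases σ
  · exact h2.1
  · exact h2.2

/-- What `edgeOK = true` says, as propositions. [cell] -/
theorem edgeOK_cases {σ : Bool} {i : ℕ} {Q : ℤ} (h : edgeOK σ i Q = true) :
    (WQ σ i Q = sval σ i ∧ (0 ≤ Q ∨ 833 * -Q ≤ 4 * psiZ (sval σ i))) ∨
    (WQ σ i Q ≠ sval σ i ∧ idxG (WQ σ i Q).natAbs < 9216 ∧
      valG (idxG (WQ σ i Q).natAbs) = (WQ σ i Q).natAbs ∧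
      psiZ (WQ σ i Q) ≤ psiZ (sval σ i) + defQ σ i Q ∧
      ((0 < defQ σ i Q ∧ 2 * gainQ σ i Q ≤ 7 * defQ σ i Q) ∨
       (¬ 0 < defQ σ i Q ∧ 833 * gainQ σ i Q ≤ 4 * psiZ (sval σ i) ∧
          pairOK (WQ σ i Q) (gainQ σ i Q) = true))) := by
  unfold edgeOK at h
  split_ifs at h with hWV hd
  · simp only [Bool.or_eq_true, decide_eq_true_eq] at h
    exact Or.inl ⟨hWV, h⟩
  · simp only [Bool.and_eq_true, decide_eq_true_eq] at h
    exact Or.inr ⟨hWV, h.1.1.1, h.1.1.2, h.1.2, Or.inl ⟨hd, h.2⟩⟩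
  · simp only [Bool.and_eq_true, decide_eq_true_eq] at h
    exact Or.inr ⟨hWV, h.1.1.1, h.1.1.2, h.1.2, Or.inr ⟨hd, h.2.1, h.2.2⟩⟩

/-- What `pairOK = true` says for one letter of the `binary16` row. [cell] -/
theorem pairOK_sound {W δf Q' : ℤ} (h : pairOK W δf = true) (hQ' : Q' ∈ lamQ) :
    rneB16 2 (W + Q') = W ∨
      2 * (δf + (rneB16 2 (W + Q') - W - Q'))
        ≤ 23 * ((Q'.natAbs : ℤ) - (rneB16 2 (W + Q') - W - Q')) := by
  have h1 := List.all_eq_true.mp h Q' hQ'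
  simp only [Bool.or_eq_true, decide_eq_true_eq] at h1
  exact h1

end ThetaE2M1Fp16

open ThetaE2M1 (lamQ exists_of_mem_piE2M1)

/-! ### The certificate -/

/-- THE θ-CERTIFICATE OF E2M1²→binary16 (RNE, sequential, the saturating model): letters `piE2M1`,
states `SH`, potential `psiH`, `θ = 833/4`, `ρ = 7/2`, `β_pair = 23/2`, `κ = 4/833`.
[cell certificate, kernel-checked] -/
theorem thetaCert_E2M1_Binary16 :
    ThetaCertificate Format.Binary16 (fun q => q ∈ piE2M1) SH psiH
      (833 / 4) (7 / 2) (23 / 2) (4 / 833) where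
  θ_pos := by norm_num
  ρ_nonneg := by norm_num
  βp_nonneg := by norm_num
  κ_nonneg := by norm_num
  start := by
    intro q hq
    obtain ⟨Q, hQ, rfl⟩ := exists_of_mem_piE2M1 hq
    have hs := starts_ok Q hQ
    unfold startOK at hs
    simp only [Bool.and_eq_true, decide_eq_true_eq] at hs
    obtain ⟨⟨⟨h0, h1⟩, h2⟩, h3⟩ := hs
    refine ⟨?_, SH_of_idx h1 h2, ?_⟩
    · obtain ⟨y, hy⟩ := exists_toRat_eq_rneB16 (g := 2) (by norm_num) Q
      refine ⟨y, ?_⟩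
      rw [hy, h0]; norm_num
    · rw [psiH_quarter, abs_div, abs_of_pos (by norm_num : (0 : ℚ) < 4), ← Int.cast_abs,
        ← Int.natCast_natAbs]
      have : ((psiZ Q : ℤ) : ℚ) ≤ ((Q.natAbs : ℤ) : ℚ) := by exact_mod_cast h3
      exact div_le_div_of_nonneg_right (by exact_mod_cast this) (by norm_num)
  closed := by
    rintro v q ⟨σ, i, hi, rfl⟩ hq
    obtain ⟨Q, hQ, rfl⟩ := exists_of_mem_piE2M1 hq
    rw [flStep_h]
    rcases edgeOK_cases (edge_ok σ hi hQ) with ⟨hWV, -⟩ | ⟨-, h1, h2, -, -⟩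
    · unfold WQ at hWV; rw [hWV]; exact ⟨σ, i, hi, rfl⟩
    · exact SH_of_idx h1 h2
  potential := by
    rintro v q ⟨σ, i, hi, rfl⟩ hq hne
    obtain ⟨Q, hQ, rfl⟩ := exists_of_mem_piE2M1 hq
    rw [flStep_h] at hne ⊢
    rw [psiH_quarter, psiH_quarter, deficitOf_h]
    rcases edgeOK_cases (edge_ok σ hi hQ) with ⟨hWV, -⟩ | ⟨-, -, -, h3, -⟩
    · unfold WQ at hWV; exact absurd (quarter_eq_iff.mpr hWV) hne
    · unfold defQ gainQ WQ at h3
      have h3' : ((psiZ (rneB16 2 (sval σ i + Q)) : ℤ) : ℚ)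
          ≤ ((psiZ (sval σ i) + ((Q.natAbs : ℤ) - (rneB16 2 (sval σ i + Q) - sval σ i - Q)) : ℤ) : ℚ) := by
        exact_mod_cast h3
      push_cast at h3' ⊢
      linarith
  capacity := by
    rintro v q ⟨σ, i, hi, rfl⟩ hq habs hneg
    obtain ⟨Q, hQ, rfl⟩ := exists_of_mem_piE2M1 hq
    rw [flStep_h, quarter_eq_iff] at habs
    have hQ0 : Q < 0 := by
      have : (Q : ℚ) < 0 := by
        by_contra hc; push Not at hc
        exact absurd hneg (not_lt.mpr (div_nonneg hc (by norm_num)))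
      exact_mod_cast this
    rw [psiH_quarter]
    rcases edgeOK_cases (edge_ok σ hi hQ) with ⟨-, hcap⟩ | ⟨hWV, -⟩
    · rcases hcap with h | h
      · omega
      · have h' : ((833 * -Q : ℤ) : ℚ) ≤ ((4 * psiZ (sval σ i) : ℤ) : ℚ) := by exact_mod_cast h
        push_cast at h'
        rw [show (833 : ℚ) / 4 * -((Q : ℚ) / 4) = 833 * -(Q : ℚ) / 4 / 4 by ring]
        exact div_le_div_of_nonneg_right (by linarith) (by norm_num)
    · exact absurd habs hWV
  paid := by
    rintro v q ⟨σ, i, hi, rfl⟩ hq hne hpos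
    obtain ⟨Q, hQ, rfl⟩ := exists_of_mem_piE2M1 hq
    rw [flStep_h] at hne
    rw [deficitOf_h] at hpos ⊢
    rw [gainOf_h]
    have hpos' : (0 : ℤ) < (Q.natAbs : ℤ) - (rneB16 2 (sval σ i + Q) - sval σ i - Q) := by
      have : (0 : ℚ) < (((Q.natAbs : ℤ) - (rneB16 2 (sval σ i + Q) - sval σ i - Q) : ℤ) : ℚ) := by
        by_contra hc; push Not at hc
        exact absurd hpos (not_lt.mpr (div_nonpos_of_nonpos_of_nonneg hc (by norm_num)))
      exact_mod_cast this
    rcases edgeOK_cases (edge_ok σ hi hQ) with ⟨hWV, -⟩ | ⟨-, -, -, -, hmv⟩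
    · unfold WQ at hWV; exact absurd (quarter_eq_iff.mpr hWV) hne
    · rcases hmv with ⟨-, h⟩ | ⟨hd, -, -⟩
      · unfold defQ gainQ WQ at h
        have h' : ((2 * (rneB16 2 (sval σ i + Q) - sval σ i - Q) : ℤ) : ℚ)
            ≤ ((7 * ((Q.natAbs : ℤ) - (rneB16 2 (sval σ i + Q) - sval σ i - Q)) : ℤ) : ℚ) := by
          exact_mod_cast h
        push_cast at h' ⊢
        rw [← mul_div_assoc, div_le_div_iff_of_pos_right (by norm_num : (0 : ℚ) < 4)]
        linarith
      · unfold defQ gainQ WQ at hd; exact absurd hpos' hd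
  free := by
    rintro v q ⟨σ, i, hi, rfl⟩ hq hne hd0
    obtain ⟨Q, hQ, rfl⟩ := exists_of_mem_piE2M1 hq
    have h4 : (0 : ℚ) < 4 := by norm_num
    rw [flStep_h] at hne ⊢
    rw [deficitOf_h] at hd0
    rw [gainOf_h, psiH_quarter]
    have hd0' : (Q.natAbs : ℤ) - (rneB16 2 (sval σ i + Q) - sval σ i - Q) = 0 := by
      have : ((((Q.natAbs : ℤ) - (rneB16 2 (sval σ i + Q) - sval σ i - Q)) : ℤ) : ℚ) = 0 := by
        rcases div_eq_zero_iff.mp hd0 with h | h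
        · exact h
        · exact absurd h (ne_of_gt h4)
      exact_mod_cast this
    rcases edgeOK_cases (edge_ok σ hi hQ) with ⟨hWV, -⟩ | ⟨-, h1, h2, -, hmv⟩
    · unfold WQ at hWV; exact absurd (quarter_eq_iff.mpr hWV) hne
    rcases hmv with ⟨hd, -⟩ | ⟨-, hκ, hpair⟩
    · unfold defQ gainQ WQ at hd; omega
    unfold gainQ WQ at hκ hpair
    refine ⟨?_, ?_⟩
    · have h' : ((833 * (rneB16 2 (sval σ i + Q) - sval σ i - Q) : ℤ) : ℚ)
          ≤ ((4 * psiZ (sval σ i) : ℤ) : ℚ) := by exact_mod_cast hκ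
      push_cast at h' ⊢
      rw [← mul_div_assoc, div_le_div_iff_of_pos_right h4]
      linarith
    · intro q' hq' hne'
      obtain ⟨Q', hQ', rfl⟩ := exists_of_mem_piE2M1 hq'
      rw [flStep_h] at hne'
      rw [gainOf_h, deficitOf_h]
      rcases pairOK_sound hpair hQ' with h | h
      · exact absurd (by rw [h]) hne'
      · have h' : ((2 * ((rneB16 2 (sval σ i + Q) - sval σ i - Q)
              + (rneB16 2 (rneB16 2 (sval σ i + Q) + Q') - rneB16 2 (sval σ i + Q) - Q')) : ℤ) : ℚ)
            ≤ ((23 * ((Q'.natAbs : ℤ) - (rneB16 2 (rneB16 2 (sval σ i + Q) + Q')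
              - rneB16 2 (sval σ i + Q) - Q')) : ℤ) : ℚ) := by
          exact_mod_cast h
        push_cast at h' ⊢
        rw [← add_div, ← mul_div_assoc, div_le_div_iff_of_pos_right h4]
        linarith

end MiniFloat

end Literature.ComputerArithmetic.FloatingPoint
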